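import Summits.NavierStokesRegularity.NavierStokesRegularity.Theorems.CircuitTrace.Negative.Structure
import HarnessLib.Audit

/-!
# Line `tilted-trace-gronwall` for crux `PerpetualPump.CircuitTrace` (stmt-NavierStokesRegularity-1836)
# — LEAD'S RESHAPED SKELETON (prover-line-stmt-NavierStokesRegularity-1836-0, 2026-08-16)

Reshaped from the planner's skeleton `Cruxes/CircuitTrace/Lines/tilted-trace-gronwall.lean` (same composition idea):

* every stub is stated UNFOLDED, in the vocabulary of Mathlib + the landed
  `Theorems/CircuitTrace/Negative/LoadBearing.lean` (`circuitRHS`, `IsCyclic`) only — no local `def`s — so that each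
  stub lands verbatim as a kind=proof helper file `Theorems/PerpetualPumpCircuitTrace<Stub>.lean` (`--supports`);
* planner's S2 (`QuietBlockRegular`) is split into S2a `stub_blockStaysQuiet` (the block above a `δ`-quiet valve that is
  `δ`-quiet at `t₁` stays `2δ`-quiet: first maximum principle) and S2b `stub_quietImpliesRegular` (an `ε₀`-quiet
  half-line `{j ≥ n}` on `[t₁,T)` is `H¹⁰`-regular: `θ`-weighted maximum principle at weight `θ^j lam^{4j}`, `θ ↑ 1`);
* planner's S3 (`Synchrony`) is PROVED here (`synchrony`, final-window dichotomy adapted from the sibling skeleton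
  `Lines/cold-gap-starvation.lean`'s sorry-free `synchrony_of_parts`; no `sSup` bookkeeping);
* S1, S4, S5, S6 as in the planner's skeleton (S4 without the unused a-priori hypothesis).

Units: `a_{i,n}(t) = lam^{n/5}|X_{i,n}(t)|` (critical amplitude), clock of scale `n` = `lam^{4n/5}`.
Composition: `ℓ³ ⇒ sup a ≤ A := max M 1`; if the `H¹⁰` weight were unbounded, `synchrony` (S1+S2a+S2b) gives paced
`δ`-hot fronts at arbitrarily high scales; S4 (tilt `β = 2/5`), S5 (terminal traces, `ℓ³`-bounded) and S6 (Toeplitz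
endgame) say paced fronts are impossible. `CircuitTrace_of` concludes the route decl BY NAME; sorries = the six `stub_*`.
-/

set_option linter.dupNamespace false

noncomputable section

namespace Summit.NavierStokesRegularity.NavierStokesRegularity.Cruxes.CircuitTrace.TiltedTraceGronwall

open Finset Real Set Filter Topology
open Summit.NavierStokesRegularity.NavierStokesRegularity.Theorems.CircuitTrace.Negative
  (circuitRHS IsSymm IsCyclic CircuitTrace' circuitTrace_iff)

/-! ## The six registered stubs (unfolded statements; bodies `sorry` until the helper files land) -/

/-- **S1 (HARDEST, lead): the quiet-valve budget.** For every cyclic circuit and amplitude bound `A` there are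
`δ₀ = δ₀(lam,m,coeff) > 0` and `C = C(lam,m,A)` such that for `0 < δ ≤ δ₀`, in every solution of the crux's class
with `sup a ≤ A`: if the valve scale `n ≥ 0` is `δ`-quiet on `[t₁,t₂] ⊂ (0,T)` while at every instant some mode
strictly above `n` is `δ`-active, then `δ² · lam^{4(n+1)/5} · (t₂ - t₁) ≤ C`.
Proof route: finite block energies `ℰ_N = Σ_{n<j≤N} Σ_i X_{i,j}²`; the per-scale identity
`ė_j = -2lam^{4j/5}e_j + π_{j-1} - π_j` (cyclic cancellation) telescopes to `ℰ_N' = -2Σ lam^{4j/5}e_j + π_n - π_N`;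
the a-priori bound on `[0,t₂]` confines active modes to `j ≤ J` and makes `π_N → 0`; the leak `|π_n| ≤ 2Km²δ²
lam^{3n/5}Σ_i|X_{i,n+1}|` is absorbed by scale `n+1`'s own dissipation (`-2a² + 2rδ²a ≤ r²δ⁴/2`); MVT. -/
theorem stub_valveBudget :
    ∀ lam : ℝ, 1 < lam → ∀ (m : ℕ) (coeff : Fin m → Fin m → Fin m → Option (Fin 3) → ℝ),
    IsCyclic coeff → ∀ A : ℝ, ∃ δ₀ : ℝ, 0 < δ₀ ∧ ∃ C : ℝ, ∀ δ : ℝ, 0 < δ → δ ≤ δ₀ →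
    ∀ (T : ℝ) (X : Fin m → ℤ → ℝ → ℝ), 0 < T →
    (∀ (i : Fin m) (n : ℤ), ∀ t ∈ Set.Ioo 0 T, HasDerivAt (X i n) (circuitRHS lam coeff X i n t) t) →
    (∀ (i : Fin m) (n : ℤ) (t : ℝ), n < 0 → X i n t = 0) →
    (∀ T' ∈ Set.Ioo 0 T, ∃ C : ℝ, ∀ (i : Fin m) (n : ℤ), ∀ t ∈ Set.Icc 0 T',
      lam ^ ((4 : ℝ) * n) * |X i n t| ≤ C) →
    (∀ t ∈ Set.Ico 0 T, ∀ (i : Fin m) (n : ℤ), lam ^ ((1 / 5 : ℝ) * n) * |X i n t| ≤ A) →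
    ∀ n : ℤ, 0 ≤ n → ∀ t₁ t₂ : ℝ, 0 < t₁ → t₁ ≤ t₂ → t₂ < T →
    (∀ i : Fin m, ∀ t ∈ Set.Icc t₁ t₂, lam ^ ((1 / 5 : ℝ) * n) * |X i n t| ≤ δ) →
    (∀ t ∈ Set.Icc t₁ t₂, ∃ (i : Fin m) (j : ℤ), n < j ∧ δ ≤ lam ^ ((1 / 5 : ℝ) * j) * |X i j t|) →
    δ ^ 2 * lam ^ ((4 / 5 : ℝ) * (n + 1)) * (t₂ - t₁) ≤ C := by
  sorry

/-- **S2a: the block above a quiet valve stays quiet (first maximum principle, critical units).** There is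
`δ₁ = δ₁(lam,m,coeff) > 0` such that for `0 < δ ≤ δ₁`: if the valve scale `n ≥ 0` is `δ`-quiet on `[t₁,T)` and
every mode strictly above `n` is `δ`-quiet at `t₁ ∈ (0,T)`, then every mode strictly above `n` stays `2δ`-quiet on
`[t₁,T)`. Proof route: on `[t₁,T'']`, `T'' < T`, only finitely many block modes can reach `2δ` (a-priori bound:
`a_{i,j} ≤ C'' lam^{-19j/5}`); at a first touching time `t*` of level `2δ` by a block mode `(i,j)`, all its neighbours
(scales `j-1 ≥ n`, `j`, `j+1`) are `≤ 2δ`, so `d(a²)/dt ≤ 2lam^{4j/5} a (16Km²δ² - a) < 0` at `a = 2δ` once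
`8Km²δ < 1` — contradicting the touch from below. -/
theorem stub_blockStaysQuiet :
    ∀ lam : ℝ, 1 < lam → ∀ (m : ℕ) (coeff : Fin m → Fin m → Fin m → Option (Fin 3) → ℝ) (A : ℝ),
    ∃ δ₁ : ℝ, 0 < δ₁ ∧ ∀ δ : ℝ, 0 < δ → δ ≤ δ₁ →
    ∀ (T : ℝ) (X : Fin m → ℤ → ℝ → ℝ), 0 < T →
    (∀ (i : Fin m) (n : ℤ), ∀ t ∈ Set.Ioo 0 T, HasDerivAt (X i n) (circuitRHS lam coeff X i n t) t) →
    (∀ (i : Fin m) (n : ℤ) (t : ℝ), n < 0 → X i n t = 0) →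
    (∀ T' ∈ Set.Ioo 0 T, ∃ C : ℝ, ∀ (i : Fin m) (n : ℤ), ∀ t ∈ Set.Icc 0 T',
      lam ^ ((4 : ℝ) * n) * |X i n t| ≤ C) →
    (∀ t ∈ Set.Ico 0 T, ∀ (i : Fin m) (n : ℤ), lam ^ ((1 / 5 : ℝ) * n) * |X i n t| ≤ A) →
    ∀ n : ℤ, 0 ≤ n → ∀ t₁ ∈ Set.Ioo 0 T,
    (∀ i : Fin m, ∀ t ∈ Set.Ico t₁ T, lam ^ ((1 / 5 : ℝ) * n) * |X i n t| ≤ δ) →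
    (∀ (i : Fin m) (j : ℤ), n < j → lam ^ ((1 / 5 : ℝ) * j) * |X i j t₁| ≤ δ) →
    ∀ (i : Fin m) (j : ℤ), n < j → ∀ t ∈ Set.Ico t₁ T, lam ^ ((1 / 5 : ℝ) * j) * |X i j t| ≤ 2 * δ := by
  sorry

/-- **S2b: an `ε₀`-quiet half-line is `H¹⁰`-regular (weighted maximum principle, `θ ↑ 1`).** There is
`ε₀ = ε₀(lam,m,coeff) > 0` such that: if every mode at every scale `j ≥ n` (`n ≥ 0`) is `ε₀`-quiet on `[t₁,T)`,
`t₁ ∈ (0,T)`, then the crux's conclusion holds (`sup_{[0,T)} lam^{4j}|X_{i,j}| < ∞`). Proof route: for `θ ∈ (0,1)`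
put `w_{i,j} = θ^j lam^{4j}|X_{i,j}|`, `j > n`; every monomial of `Ẋ_{i,j}` has one factor bounded in critical
units by `ε₀` and one bounded by the block sup `W` of `w` (the `(j-1)²` source costs `θ lam^{16/5}`; at `j = n+1`
it is a bounded boundary forcing `β₂` from the valve), so `d(w²)/dt ≤ 2lam^{4j/5} w (-w + ηW + β₂)`,
`η = ε₀Km²(3 + lam^{16/5}) ≤ 1/2`; the sup over `j > n` is a max on `[t₁,T'']` because `θ < 1` and
`lam^{4j}|X| ≤ C''`; first-touch argument ⇒ `w ≤ W* := max(C_{t₁}, 2β₂) + 1`, uniformly in `θ`; let `θ ↑ 1`.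
Scales `0 ≤ j ≤ n` by `a ≤ A` (`lam^{4j}|X| ≤ lam^{19n/5} A⁺`), `j < 0` vanish, `[0,t₁]` by the a-priori bound. -/
theorem stub_quietImpliesRegular :
    ∀ lam : ℝ, 1 < lam → ∀ (m : ℕ) (coeff : Fin m → Fin m → Fin m → Option (Fin 3) → ℝ) (A : ℝ),
    ∃ ε₀ : ℝ, 0 < ε₀ ∧ ∀ (T : ℝ) (X : Fin m → ℤ → ℝ → ℝ), 0 < T →
    (∀ (i : Fin m) (n : ℤ), ∀ t ∈ Set.Ioo 0 T, HasDerivAt (X i n) (circuitRHS lam coeff X i n t) t) →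
    (∀ (i : Fin m) (n : ℤ) (t : ℝ), n < 0 → X i n t = 0) →
    (∀ T' ∈ Set.Ioo 0 T, ∃ C : ℝ, ∀ (i : Fin m) (n : ℤ), ∀ t ∈ Set.Icc 0 T',
      lam ^ ((4 : ℝ) * n) * |X i n t| ≤ C) →
    (∀ t ∈ Set.Ico 0 T, ∀ (i : Fin m) (n : ℤ), lam ^ ((1 / 5 : ℝ) * n) * |X i n t| ≤ A) →
    ∀ n : ℤ, 0 ≤ n → ∀ t₁ ∈ Set.Ioo 0 T,
    (∀ (i : Fin m) (j : ℤ), n ≤ j → ∀ t ∈ Set.Ico t₁ T, lam ^ ((1 / 5 : ℝ) * j) * |X i j t| ≤ ε₀) →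
    ∃ C : ℝ, ∀ (i : Fin m) (j : ℤ), ∀ t ∈ Set.Ico 0 T, lam ^ ((4 : ℝ) * j) * |X i j t| ≤ C := by
  sorry

/-- **S4: the TILTED GRÖNWALL LEVER.** For every `lam > 1`, tilt `β`, circuit and `A` there is
`Γ = Γ(lam,β,m,coeff,A) ≥ 0` such that in every solution with `sup a ≤ A` and no modes below scale `0` the tilted
low-block energy `L^β_N(t) = Σ_{k=0}^{N} Σ_i lam^{2βk} X_{i,k}(t)²` obeys
`e^{-Γ lam^{4N/5}(t₂-t₁)} L^β_N(t₁) ≤ L^β_N(t₂)` for `0 < t₁ ≤ t₂ < T`. Proof route: every monomial of `Ẋ_{i,k}`,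
`k ≤ N`, has a factor at a scale `≤ N` besides `X_{i,k}` (one-sided coupling); bound the remaining factor by
`A lam^{-j/5}`, Young, re-weight the `(k-1)²` source at price `lam^{2β}`: `|L̇| ≤ Γ lam^{4N/5} L` with
`Γ = 2 + Km²A⁺(7 + lam^{2β})`; integrating factor `e^{Γ lam^{4N/5} t}`. -/
theorem stub_tiltedGronwall :
    ∀ lam : ℝ, 1 < lam → ∀ (β : ℝ) (m : ℕ) (coeff : Fin m → Fin m → Fin m → Option (Fin 3) → ℝ) (A : ℝ),
    ∃ Γ : ℝ, 0 ≤ Γ ∧ ∀ (T : ℝ) (X : Fin m → ℤ → ℝ → ℝ),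
    (∀ (i : Fin m) (n : ℤ), ∀ t ∈ Set.Ioo 0 T, HasDerivAt (X i n) (circuitRHS lam coeff X i n t) t) →
    (∀ (i : Fin m) (n : ℤ) (t : ℝ), n < 0 → X i n t = 0) →
    (∀ t ∈ Set.Ico 0 T, ∀ (i : Fin m) (n : ℤ), lam ^ ((1 / 5 : ℝ) * n) * |X i n t| ≤ A) →
    ∀ (N : ℕ) (t₁ t₂ : ℝ), 0 < t₁ → t₁ ≤ t₂ → t₂ < T →
    Real.exp (-(Γ * lam ^ ((4 / 5 : ℝ) * N) * (t₂ - t₁))) *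
        (∑ k ∈ Finset.range (N + 1), ∑ i : Fin m, lam ^ (2 * β * k) * (X i k t₁) ^ 2)
      ≤ ∑ k ∈ Finset.range (N + 1), ∑ i : Fin m, lam ^ (2 * β * k) * (X i k t₂) ^ 2 := by
  sorry

/-- **S5: the TERMINAL TRACE exists and inherits the `ℓ³` bound.** For `T > 0`, every solution of the circuit on
`(0,T)` with the crux's `ℓ³` bound `M` has mode-wise limits `τ_{i,n} = lim_{t↑T} X_{i,n}(t)`, and
`Σ_{n∈s} Σ_i (lam^{n/5}|τ_{i,n}|)³ ≤ M` for every finite `s`. Proof route: `sup a ≤ max M 1`, so `|Ẋ_{i,n}|` is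
bounded on `(0,T)` for fixed `(i,n)` (Lipschitz ⇒ Cauchy at `T⁻` ⇒ limit; cf. the kernel-checked `terminalLimit` of
`Cruxes/CircuitTrace/SketchIdeator2G2.lean`); finite sums pass to the limit and are `≤ M` on `[0,T) ∈ 𝓝[<] T`. -/
theorem stub_terminalTrace :
    ∀ lam : ℝ, 1 < lam → ∀ (m : ℕ) (coeff : Fin m → Fin m → Fin m → Option (Fin 3) → ℝ) (T M : ℝ)
    (X : Fin m → ℤ → ℝ → ℝ), 0 < T →
    (∀ (i : Fin m) (n : ℤ), ∀ t ∈ Set.Ioo 0 T, HasDerivAt (X i n) (circuitRHS lam coeff X i n t) t) →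
    (∀ (i : Fin m) (n : ℤ) (t : ℝ), n < 0 → X i n t = 0) →
    (∀ t ∈ Set.Ico 0 T, ∀ s : Finset ℤ,
      ∑ n ∈ s, ∑ i : Fin m, (lam ^ ((1 / 5 : ℝ) * n) * |X i n t|) ^ 3 ≤ M) →
    ∃ τ : Fin m → ℤ → ℝ,
      (∀ (i : Fin m) (n : ℤ), Filter.Tendsto (X i n) (nhdsWithin T (Set.Iio T)) (nhds (τ i n))) ∧
      ∀ s : Finset ℤ, ∑ n ∈ s, ∑ i : Fin m, (lam ^ ((1 / 5 : ℝ) * n) * |τ i n|) ^ 3 ≤ M := by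
  sorry

/-- **S6: the TRACE ENDGAME (tilted Grönwall read at `T⁻` + Toeplitz).** Pure real analysis, no ODE: if functions
`X_{i,n}` obey the tilted Grönwall inequality with tilt `β > 1/5` and some `Γ` on `(0,T)`, have terminal traces `τ`
at `T⁻`, and the traces are `ℓ³`-bounded in critical units, then there are NO paced fronts at level `δ > 0`, pace
`R`, along `n → ∞`. Proof route: at a front `(n,i,t)`, `L^β_n(t₂) ≥ e^{-Γ⁺R⁺} δ² lam^{(2β-2/5)n}` for
`t₂ ∈ [t,T)`; `t₂ ↑ T` gives `Σ_{k≤n}Σ_i θ^{n-k} σ²_{i,k} ≥ e^{-Γ⁺R⁺}δ²` (`σ_{i,k} = lam^{k/5}|τ_{i,k}|`,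
`θ = lam^{-(2β-2/5)} < 1`) at infinitely many `n`; but `Σσ³ ≤ M` on finite sets makes `{k : ∃ i, σ_{i,k} ≥ ε}`
finite and `σ² ≤ M^{2/3}`, so these discounted sums tend to `0`. (`m = 0`: no front exists.) -/
theorem stub_traceEndgame :
    ∀ lam : ℝ, 1 < lam → ∀ β : ℝ, 1 / 5 < β → ∀ (m : ℕ) (Γ δ R M T : ℝ) (X : Fin m → ℤ → ℝ → ℝ)
    (τ : Fin m → ℤ → ℝ), 0 < δ →
    (∀ (N : ℕ) (t₁ t₂ : ℝ), 0 < t₁ → t₁ ≤ t₂ → t₂ < T →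
      Real.exp (-(Γ * lam ^ ((4 / 5 : ℝ) * N) * (t₂ - t₁))) *
          (∑ k ∈ Finset.range (N + 1), ∑ i : Fin m, lam ^ (2 * β * k) * (X i k t₁) ^ 2)
        ≤ ∑ k ∈ Finset.range (N + 1), ∑ i : Fin m, lam ^ (2 * β * k) * (X i k t₂) ^ 2) →
    (∀ (i : Fin m) (n : ℤ), Filter.Tendsto (X i n) (nhdsWithin T (Set.Iio T)) (nhds (τ i n))) →
    (∀ s : Finset ℤ, ∑ n ∈ s, ∑ i : Fin m, (lam ^ ((1 / 5 : ℝ) * n) * |τ i n|) ^ 3 ≤ M) →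
    ¬ (∀ n₀ : ℕ, ∃ n : ℕ, n₀ ≤ n ∧ ∃ i : Fin m, ∃ t ∈ Set.Ioo 0 T,
        lam ^ ((4 / 5 : ℝ) * n) * (T - t) ≤ R ∧ δ ≤ lam ^ ((1 / 5 : ℝ) * n) * |X i n t|) := by
  sorry

/-! ## Proved glue -/

/-- From the crux's `ℓ³` hypothesis every critical amplitude is `≤ max M 1` (a single cube is `≤ M`). -/
theorem critSupBound_of_l3 {lam : ℝ} (hlam : 1 < lam) {m : ℕ} {T M : ℝ} {X : Fin m → ℤ → ℝ → ℝ}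
    (hM : ∀ t ∈ Set.Ico 0 T, ∀ s : Finset ℤ,
      ∑ n ∈ s, ∑ i : Fin m, (lam ^ ((1 / 5 : ℝ) * n) * |X i n t|) ^ 3 ≤ M) :
    ∀ t ∈ Set.Ico 0 T, ∀ (i : Fin m) (n : ℤ), lam ^ ((1 / 5 : ℝ) * n) * |X i n t| ≤ max M 1 := by
  have hlam0 : 0 < lam := by linarith
  intro t ht i n
  have h1 := hM t ht {n}
  rw [Finset.sum_singleton] at h1
  have hpow : 0 ≤ lam ^ ((1 / 5 : ℝ) * n) := (Real.rpow_pos_of_pos hlam0 _).le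
  have h0 : 0 ≤ lam ^ ((1 / 5 : ℝ) * n) * |X i n t| := mul_nonneg hpow (abs_nonneg _)
  have h2 : (lam ^ ((1 / 5 : ℝ) * n) * |X i n t|) ^ 3 ≤ M :=
    le_trans (Finset.single_le_sum (f := fun j => (lam ^ ((1 / 5 : ℝ) * n) * |X j n t|) ^ 3)
      (fun j _ => pow_nonneg (mul_nonneg hpow (abs_nonneg _)) 3) (Finset.mem_univ i)) h1
  by_contra hlt
  have hlt' := not_le.mp hlt
  set x := lam ^ ((1 / 5 : ℝ) * n) * |X i n t| with hx
  have h3 : 1 ≤ x := (lt_of_le_of_lt (le_max_right _ _) hlt').le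
  have h4 : M < x := lt_of_le_of_lt (le_max_left _ _) hlt'
  have h5 : x ≤ x ^ 3 := by
    have hx1 : 1 ≤ x * x := by nlinarith
    calc x = x * 1 := (mul_one x).symm
      _ ≤ x * (x * x) := mul_le_mul_of_nonneg_left hx1 h0
      _ = x ^ 3 := by ring
  linarith

/-- Own-clock windows shrink: for `lam > 1`, `R ≥ 0`, `T > 0` there is a scale `g₀` beyond which
`R · lam^{-4g/5} < T` (adapted from `Lines/cold-gap-starvation.lean`, `exists_window_lt`). -/
theorem exists_window_lt {lam : ℝ} (hlam : 1 < lam) {R T : ℝ} (hR : 0 ≤ R) (hT : 0 < T) :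
    ∃ g₀ : ℕ, ∀ g : ℕ, g₀ ≤ g → R * lam ^ (-((4 / 5 : ℝ) * g)) < T := by
  have hlam0 : 0 < lam := by linarith
  set r : ℝ := lam ^ (-(4 / 5 : ℝ)) with hr
  have hr1 : r < 1 := Real.rpow_lt_one_of_one_lt_of_neg hlam (by norm_num)
  have hpow : ∀ g : ℕ, lam ^ (-((4 / 5 : ℝ) * g)) = r ^ g := by
    intro g
    rw [hr, ← Real.rpow_natCast, ← Real.rpow_mul hlam0.le]
    congr 1
    ring
  obtain ⟨n, hn⟩ := exists_pow_lt_of_lt_one (show 0 < T / (R + 1) by positivity) hr1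
  refine ⟨n, fun g hg => ?_⟩
  have hr0 : 0 ≤ r := (Real.rpow_pos_of_pos hlam0 _).le
  have hmono : r ^ g ≤ r ^ n := pow_le_pow_of_le_one hr0 hr1.le hg
  have hRT : R * (T / (R + 1)) < T := by
    have hR1 : (0 : ℝ) < R + 1 := by linarith
    have hlt : R / (R + 1) < 1 := by rw [div_lt_one hR1]; linarith
    calc R * (T / (R + 1)) = R / (R + 1) * T := by ring
      _ < 1 * T := mul_lt_mul_of_pos_right hlt hT
      _ = T := one_mul T
  calc R * lam ^ (-((4 / 5 : ℝ) * g)) = R * r ^ g := by rw [hpow]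
    _ ≤ R * r ^ n := mul_le_mul_of_nonneg_left hmono hR
    _ ≤ R * (T / (R + 1)) := mul_le_mul_of_nonneg_left hn.le hR
    _ < T := hRT

/-- **SYNCHRONY (planner's S3), proved from S1 + S2a + S2b.** For every cyclic circuit and amplitude bound `A` there
are `δ > 0` and `R` such that every solution of the crux's class with `sup a ≤ A` whose `H¹⁰` weight is unbounded on
`[0,T)` has, at arbitrarily high scales `g`, a `δ`-hot instant `t ∈ (0,T)` with `lam^{4g/5}(T - t) ≤ R` (paced
fronts; the proof gives one at EVERY large scale). Argument: `δ := min δ₀ (min δ₁ (ε₀/2))`, `R := 2C⁺/δ² + 2`; if the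
final window `[T - R·lam^{-4g/5}, T)` of a large scale `g` carries no `δ`-hot instant of `g`, the valve `g` is quiet
there; either the block above `g` is `δ`-quiet at some instant of the window (S2a: it stays `2δ ≤ ε₀`-quiet, S2b:
regular — contradiction) or it is active at every instant, and S1 on the first half of the window gives
`C⁺ + δ² ≤ C`. -/
theorem synchrony {lam : ℝ} (hlam : 1 < lam) {m : ℕ}
    (coeff : Fin m → Fin m → Fin m → Option (Fin 3) → ℝ) (hcyc : IsCyclic coeff) (A : ℝ) :
    ∃ δ : ℝ, 0 < δ ∧ ∃ R : ℝ, ∀ (T : ℝ) (X : Fin m → ℤ → ℝ → ℝ), 0 < T →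
      (∀ (i : Fin m) (n : ℤ), ∀ t ∈ Set.Ioo 0 T, HasDerivAt (X i n) (circuitRHS lam coeff X i n t) t) →
      (∀ (i : Fin m) (n : ℤ) (t : ℝ), n < 0 → X i n t = 0) →
      (∀ T' ∈ Set.Ioo 0 T, ∃ C : ℝ, ∀ (i : Fin m) (n : ℤ), ∀ t ∈ Set.Icc 0 T',
        lam ^ ((4 : ℝ) * n) * |X i n t| ≤ C) →
      (∀ t ∈ Set.Ico 0 T, ∀ (i : Fin m) (n : ℤ), lam ^ ((1 / 5 : ℝ) * n) * |X i n t| ≤ A) →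
      (¬ ∃ C : ℝ, ∀ (i : Fin m) (j : ℤ), ∀ t ∈ Set.Ico 0 T, lam ^ ((4 : ℝ) * j) * |X i j t| ≤ C) →
      ∀ n₀ : ℕ, ∃ n : ℕ, n₀ ≤ n ∧ ∃ i : Fin m, ∃ t ∈ Set.Ioo 0 T,
        lam ^ ((4 / 5 : ℝ) * n) * (T - t) ≤ R ∧ δ ≤ lam ^ ((1 / 5 : ℝ) * n) * |X i n t| := by
  obtain ⟨δ₀, hδ₀, C, hV⟩ := stub_valveBudget lam hlam m coeff hcyc A
  obtain ⟨δ₁, hδ₁, hQ⟩ := stub_blockStaysQuiet lam hlam m coeff A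
  obtain ⟨ε₀, hε₀, hReg⟩ := stub_quietImpliesRegular lam hlam m coeff A
  have hlam0 : 0 < lam := by linarith
  set δ : ℝ := min δ₀ (min δ₁ (ε₀ / 2)) with hδdef
  have hδ : 0 < δ := lt_min hδ₀ (lt_min hδ₁ (by linarith))
  have hδ₀' : δ ≤ δ₀ := min_le_left _ _
  have hδ₁' : δ ≤ δ₁ := (min_le_right _ _).trans (min_le_left _ _)
  have hδε : 2 * δ ≤ ε₀ := by
    have : δ ≤ ε₀ / 2 := (min_le_right _ _).trans (min_le_right _ _)
    linarith
  set R : ℝ := 2 * max C 0 / δ ^ 2 + 2 with hRdef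
  have hR0 : 0 ≤ R := by
    have : 0 ≤ 2 * max C 0 / δ ^ 2 := by positivity
    rw [hRdef]; linarith
  refine ⟨δ, hδ, R, fun T X hT hderiv hcut hapr hA hnreg n₀ => ?_⟩
  obtain ⟨g₀, hwin⟩ := exists_window_lt hlam hR0 hT
  set g : ℕ := max n₀ g₀ with hgdef
  refine ⟨g, le_max_left _ _, ?_⟩
  by_contra hno
  push Not at hno
  -- hno : ∀ i, ∀ t ∈ Ioo 0 T, lam^{4g/5}(T - t) ≤ R → a_{i,g}(t) < δ
  set w : ℝ := R * lam ^ (-((4 / 5 : ℝ) * g)) with hwdef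
  have hwT : w < T := hwin g (le_max_right _ _)
  have hpow0 : 0 < lam ^ ((4 / 5 : ℝ) * g) := Real.rpow_pos_of_pos hlam0 _
  have hcancel : lam ^ ((4 / 5 : ℝ) * g) * lam ^ (-((4 / 5 : ℝ) * g)) = 1 := by
    rw [Real.rpow_neg hlam0.le, mul_inv_cancel₀ hpow0.ne']
  have hw0 : 0 < w := by
    have hR2 : 2 ≤ R := by
      have : 0 ≤ 2 * max C 0 / δ ^ 2 := by positivity
      rw [hRdef]; linarith
    rw [hwdef]
    exact mul_pos (by linarith) (Real.rpow_pos_of_pos hlam0 _)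
  set t₁ : ℝ := T - w with ht₁def
  have ht₁0 : 0 < t₁ := by rw [ht₁def]; linarith
  have ht₁T : t₁ < T := by rw [ht₁def]; linarith
  -- the valve g is δ-quiet on [t₁, T)
  have hvalve : ∀ i : Fin m, ∀ t ∈ Set.Ico t₁ T, lam ^ ((1 / 5 : ℝ) * (g : ℤ)) * |X i g t| < δ := by
    intro i t ht
    have h := hno i t ⟨lt_of_lt_of_le ht₁0 ht.1, ht.2⟩ (by
      have h1 : T - t ≤ w := by have := ht.1; rw [ht₁def] at this; linarith
      calc lam ^ ((4 / 5 : ℝ) * g) * (T - t) ≤ lam ^ ((4 / 5 : ℝ) * g) * w :=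
            mul_le_mul_of_nonneg_left h1 hpow0.le
        _ = R := by rw [hwdef, mul_left_comm, hcancel, mul_one])
    exact_mod_cast h
  have hg0 : (0 : ℤ) ≤ (g : ℤ) := Int.natCast_nonneg g
  by_cases hcase : ∃ t' ∈ Set.Ico t₁ T, ∀ (i : Fin m) (j : ℤ), (g : ℤ) < j →
      lam ^ ((1 / 5 : ℝ) * j) * |X i j t'| ≤ δ
  · -- Case A: the block above g is δ-quiet at some instant t' of the window ⇒ regular
    obtain ⟨t', ht', hblock⟩ := hcase
    have ht'0 : 0 < t' := lt_of_lt_of_le ht₁0 ht'.1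
    have hval' : ∀ i : Fin m, ∀ t ∈ Set.Ico t' T, lam ^ ((1 / 5 : ℝ) * (g : ℤ)) * |X i g t| ≤ δ :=
      fun i t ht => (hvalve i t ⟨le_trans ht'.1 ht.1, ht.2⟩).le
    have h2δ := hQ δ hδ hδ₁' T X hT hderiv hcut hapr hA g hg0 t' ⟨ht'0, ht'.2⟩ hval' hblock
    refine hnreg (hReg T X hT hderiv hcut hapr hA g hg0 t' ⟨ht'0, ht'.2⟩ ?_)
    intro i j hj t ht
    rcases eq_or_lt_of_le hj with hjg | hjg
    · rw [← hjg]
      have := hval' i t ht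
      linarith
    · exact (h2δ i j hjg t ht).trans hδε
  · -- Case B: at every instant of the window some mode above g is δ-active ⇒ valve budget on [t₁, T - w/2]
    push Not at hcase
    set t₂ : ℝ := T - w / 2 with ht₂def
    have ht₁₂ : t₁ ≤ t₂ := by rw [ht₁def, ht₂def]; linarith
    have ht₂T : t₂ < T := by rw [ht₂def]; linarith
    have hbud := hV δ hδ hδ₀' T X hT hderiv hcut hapr hA g hg0 t₁ t₂ ht₁0 ht₁₂ ht₂T
      (fun i t ht => (hvalve i t ⟨ht.1, lt_of_le_of_lt ht.2 ht₂T⟩).le)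
      (fun t ht => by
        obtain ⟨i, j, hj, hlt⟩ := hcase t ⟨ht.1, lt_of_le_of_lt ht.2 ht₂T⟩
        exact ⟨i, j, hj, hlt.le⟩)
    -- window algebra: δ² lam^{4(g+1)/5} (t₂ - t₁) = δ² lam^{4/5} R / 2 ≥ max C 0 + δ²
    have hlen : t₂ - t₁ = R / 2 * lam ^ (-((4 / 5 : ℝ) * g)) := by
      rw [ht₂def, ht₁def, hwdef]; ring
    have hsplit : lam ^ ((4 / 5 : ℝ) * (((g : ℤ) : ℝ) + 1))
        = lam ^ ((4 / 5 : ℝ) * g) * lam ^ (4 / 5 : ℝ) := by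
      rw [← Real.rpow_add hlam0]
      push_cast
      ring_nf
    have hval : δ ^ 2 * lam ^ ((4 / 5 : ℝ) * (((g : ℤ) : ℝ) + 1)) * (t₂ - t₁)
        = δ ^ 2 * lam ^ (4 / 5 : ℝ) * (R / 2) := by
      rw [hlen, hsplit]
      calc δ ^ 2 * (lam ^ ((4 / 5 : ℝ) * g) * lam ^ (4 / 5 : ℝ)) * (R / 2 * lam ^ (-((4 / 5 : ℝ) * g)))
          = δ ^ 2 * lam ^ (4 / 5 : ℝ) * (R / 2)
              * (lam ^ ((4 / 5 : ℝ) * g) * lam ^ (-((4 / 5 : ℝ) * g))) := by ring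
        _ = δ ^ 2 * lam ^ (4 / 5 : ℝ) * (R / 2) := by rw [hcancel, mul_one]
    rw [hval] at hbud
    have h45 : 1 ≤ lam ^ (4 / 5 : ℝ) := Real.one_le_rpow hlam.le (by norm_num)
    have hδ2 : 0 < δ ^ 2 := by positivity
    have hR2 : δ ^ 2 * (R / 2) = max C 0 + δ ^ 2 := by
      rw [hRdef]
      field_simp
    have hlow : δ ^ 2 * (R / 2) ≤ δ ^ 2 * lam ^ (4 / 5 : ℝ) * (R / 2) := by
      have hR2' : 0 ≤ R / 2 := by linarith
      calc δ ^ 2 * (R / 2) = δ ^ 2 * 1 * (R / 2) := by ring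
        _ ≤ δ ^ 2 * lam ^ (4 / 5 : ℝ) * (R / 2) := by gcongr
    have hC : C ≤ max C 0 := le_max_left _ _
    linarith

/-- **Composition (sorry-free modulo the stubs): the crux in its restated form `CircuitTrace'`.** Fix the crux data
with `ℓ³` bound `M` and suppose the `H¹⁰` weight is unbounded on `[0,T)`; `A := max M 1` bounds every critical
amplitude (`critSupBound_of_l3`); `synchrony` gives paced fronts `(δ, R)`; S4 with tilt `β = 2/5 > 1/5` gives `Γ`
and the tilted Grönwall inequality; S5 the terminal trace with its `ℓ³` bound; S6 says paced fronts are then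
impossible. -/
theorem circuitTrace_of_parts : CircuitTrace' := by
  intro lam hlam m coeff _hsym hcyc T hT X _hcont hderiv hcut hapr hM3
  obtain ⟨M, hM⟩ := hM3
  by_contra hreg
  have hA := critSupBound_of_l3 hlam hM
  obtain ⟨δ, hδ, R, hsync⟩ := synchrony hlam coeff hcyc (max M 1)
  have hfr := hsync T X hT hderiv hcut hapr hA hreg
  obtain ⟨Γ, _hΓ, hgr⟩ := stub_tiltedGronwall lam hlam (2 / 5) m coeff (max M 1)
  obtain ⟨τ, hτ, hτM⟩ := stub_terminalTrace lam hlam m coeff T M X hT hderiv hcut hM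
  exact stub_traceEndgame lam hlam (2 / 5) (by norm_num) m Γ δ R M T X τ hδ (hgr T X hderiv hcut hA) hτ hτM hfr

/-- **The skeleton concludes the crux BY NAME**: the six registered stubs, fed through `synchrony` and
`circuitTrace_of_parts` and transported along the landed `circuitTrace_iff` (`Iff.rfl`), give
`Summit.NavierStokesRegularity.NavierStokesRegularity.Theses.PerpetualPump.CircuitTrace`. -/
theorem CircuitTrace_of :
    _root_.Summit.NavierStokesRegularity.NavierStokesRegularity.Theses.PerpetualPump.CircuitTrace :=
  circuitTrace_iff.mpr circuitTrace_of_parts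

end Summit.NavierStokesRegularity.NavierStokesRegularity.Cruxes.CircuitTrace.TiltedTraceGronwall

end
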